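import Literature.Probability.Process.RenewalRatioRateLog
import Literature.Probability.Process.RenewalTheorem
import Literature.Probability.RandomPlanarGeometry.HexSAWBrickWallBridgeDivergence
import Literature.Probability.RandomPlanarGeometry.HexSAWBrickWallBridgeRatio
import Literature.Probability.RandomPlanarGeometry.HexSAWHalfSpaceRatioLimit
import Literature.Probability.RandomPlanarGeometry.HexSAWBrickWallKestenRelation
import Literature.Probability.RandomPlanarGeometry.HexSAWHammersleyWelshExplicit
import HarnessLib

/-!
# One-step ratio RATES on the hexagonal lattice (brick-wall frame):
# `|b_{N+1}(ℍ)/b_N(ℍ) − μ_ℍ| ≤ K/log N` and `|h_{N+1}(ℍ)/h_N(ℍ) − μ_ℍ| ≤ K/log N`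

Topic `Literature/Probability/RandomPlanarGeometry` (brick-wall bridges and half-space walks of `ℍ` by length,
height = coordinate `0`: `HexBW.bridgeCount`, `HexBW.halfSpaceCount`; inputs by name: the renewal equation
`HexBW.bridgeCount_eq_sum_Icc` / `_range`, the renewal inequality `HexBW.sum_irreducibleBridgeCount_mul_halfSpaceCount_le`
and `HexBW.irreducibleBridgeCount_one_pos` (`HexSAWBrickWallRenewal.lean`), the partial sums of Kesten's series
`HexBW.sum_irreducibleBridgeCount_div_pow_le_one` (`HexSAWBrickWallKestenRelation.lean`), the divergence rate (3.1.14)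
`HexBW.half_log_le_sum_bridgeCount` (`HexSAWBrickWallBridgeDivergence.lean`), the two-step rates
`HV.hexBridgeRatioTwo_rate_mixed` (`HexSAWBrickWallBridgeRatio.lean`) and `hexHalfSpaceRatioTwo_rate`
(`HexSAWHalfSpaceRatioLimit.lean`); engine: the model-free `Renewal.LogRate.ratio_rate_log_of`
(`Process/RenewalRatioRateLog.lean`)).

Sources: N. Madras, G. Slade, *The Self-Avoiding Walk* (1993), Theorem 7.3.4 (d) and its proof via (7.3.14)
(pp. 248–249), (4.2.2)–(4.2.5) (pp. 90–91), Appendix B (B.5), (3.1.14) (p. 62); G. F. Lawler, O. Schramm, W. Werner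
(2004), Appendix A (A.3).  Status in print: the one-step LIMITS are printed for `ℤ^d` only (bridges: M–S Thm
7.3.4(d); half-space walks: LSW (A.3)); NO RATE is printed for any lattice (the `ℤ^d` rate `K/log N` is the
tree's `Zd.bridgeRatio_rate_log` / `Zd.halfSpaceRatio_rate_log_of`; M–S's Notes to Chapter 7, p. 255, print Kesten's
rates (7.5.1)–(7.5.2) for the walk and fixed-endpoint ratios only and refer part (d) to "a ratio limit theorem in
renewal theory; see Proposition 1.2 in Chapter 3 of Orey (1971)").  On `ℍ` the limits are the lane's R85/R84;
this file adds the rates (lane «pcv-sawmu», route R86).  The input Kesten relation `HexBW.kestenRelation` of the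
present brick-wall frame (bridges crossing perpendicularly to an edge class) is STATED in print without proof, for the
"PP-bridges" of the honeycomb lattice "oriented so that it contains horizontal edges", by N. R. Beaton, J. Phys. A 47
(2014) 075003, Appendix, display before Lemma 16 ("Kesten's relation for irreducible bridges … can be adapted to our
lattice without difficulty. It gives `Σ_{γ∈iSAPP} x_c^{|γ|} = 1`"); the tree's `HexSAWBrickWallKestenRelation.lean` is
its first written proof.
[cite: MadrasSlade1993, §7.5 Notes (p. 255), (7.5.1)–(7.5.2) and the remark on Theorem 7.3.4 (d)]
[cite: Beaton2014RotatedHoneycomb, Appendix (display before Lemma 16)]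

## Main statements (namespace `Literature.Probability.RandomPlanarGeometry.SAW`)

* `HexBW.kestenTail_le_inv_log : 1 − Σ_{k≤m} λ_k(ℍ) μ_ℍ^{-k} ≤ 1/(1 + ½ log(m/μ_ℍ))` (`m ≥ max(1, μ_ℍ)`);
* **`hexBridgeRatioOne_rate : ∃ K, ∀ N ≥ 2, |b_{N+1}(ℍ)/b_N(ℍ) − μ_ℍ| ≤ K / log N`**;
* **`hexHalfSpaceRatioOne_rate : ∃ K, ∀ N ≥ 2, |h_{N+1}(ℍ)/h_N(ℍ) − μ_ℍ| ≤ K / log N`**.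
-/

noncomputable section

open Finset Filter Topology
open scoped BigOperators

namespace Literature.Probability.RandomPlanarGeometry.SAW

namespace HexBW

/-- `Σ_{1 ≤ k ≤ n} g k = Σ_{k < n} g (k+1)`. [cite: MadrasSlade1993, Appendix B] -/
private theorem sum_Icc_one_eq_sum_range (g : ℕ → ℝ) (n : ℕ) :
    ∑ k ∈ Icc 1 n, g k = ∑ k ∈ range n, g (k + 1) := by
  induction n with
  | zero => simp
  | succ n ih => rw [Finset.sum_Icc_succ_top (by omega), ih, Finset.sum_range_succ]

/-- **The explicit Kesten tail for brick-wall bridges of `ℍ`**: `1 − Σ_{1≤k≤m} λ_k(ℍ) μ_ℍ^{-k} ≤ 1/(1 + ½ log(m/μ_ℍ))`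
for `m ≥ 1` with `μ_ℍ ≤ m`: the conservation law (B.5) for the renewal sequence `u_n = b_n(ℍ) μ_ℍ^{-n}` gives
`T_m · Σ_{n≤m} u_n ≤ 1` (the tails `T_k` are antitone), and `Σ_{n≤m} u_n = 1 + B⁺_m(1/μ_ℍ) ≥ 1 + ½ log(m/μ_ℍ)`
by (3.1.14) on `ℍ` (`HexBW.half_log_le_sum_bridgeCount`).
[cite: MadrasSlade1993, eq. (4.2.4)–(4.2.5) (p. 91), Appendix B eq. (B.5), eq. (3.1.14) (p. 62)] -/
theorem kestenTail_le_inv_log {m : ℕ} (hm : 1 ≤ m) (hμm : hexConnectiveConstant ≤ m) :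
    1 - ∑ k ∈ Icc 1 m, (irreducibleBridgeCount k : ℝ) / hexConnectiveConstant ^ k ≤
      1 / (1 + Real.log ((m : ℝ) / hexConnectiveConstant) / 2) := by
  obtain ⟨m', rfl⟩ : ∃ m', m = m' + 1 := ⟨m - 1, by omega⟩
  set μ := hexConnectiveConstant with hμdef
  have hμ : 0 < μ := hexConnectiveConstant_pos
  set u : ℕ → ℝ := fun n => (bridgeCount n : ℝ) / μ ^ n with hu
  set f : ℕ → ℝ := fun k => (irreducibleBridgeCount k : ℝ) / μ ^ k with hf
  set r : ℕ → ℝ := fun n => 1 - ∑ k ∈ range (n + 1), f k with hrdef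
  have hr : ∀ n, r n = 1 - ∑ k ∈ range (n + 1), f k := fun n => rfl
  have hu0 : u 0 = 1 := by simp [hu, bridgeCount_zero]
  have hf0 : f 0 = 0 := by simp [hf, irreducibleBridgeCount_zero]
  have hren : ∀ n, 1 ≤ n → u n = ∑ k ∈ range (n + 1), f k * u (n - k) := by
    intro n hn
    simp only [hu, hf]
    rw [bridgeCount_eq_sum_range hn, Finset.sum_div]
    refine Finset.sum_congr rfl fun k hk => ?_
    have hkn : k ≤ n := Nat.lt_succ_iff.1 (Finset.mem_range.1 hk)
    rw [div_mul_div_comm, ← pow_add, Nat.add_sub_cancel' hkn]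
  have hB5 := _root_.Literature.Probability.Process.Renewal.sum_tailSum_mul_eq_one hr hu0 hf0 hren (m' + 1)
  have hf_nonneg : ∀ k, 0 ≤ f k := fun k => by positivity
  have hr_anti : Antitone r := by
    refine antitone_nat_of_succ_le fun n => ?_
    rw [_root_.Literature.Probability.Process.Renewal.tailSum_succ hr n]
    linarith [hf_nonneg (n + 1)]
  have hu_nonneg : ∀ n, 0 ≤ u n := fun n => by positivity
  have h1 : r (m' + 1) * ∑ k ∈ range (m' + 1 + 1), u (m' + 1 - k) ≤ 1 := by
    rw [← hB5, Finset.mul_sum]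
    refine Finset.sum_le_sum fun k hk => ?_
    have hk' : k ≤ m' + 1 := Nat.lt_succ_iff.1 (Finset.mem_range.1 hk)
    exact mul_le_mul_of_nonneg_right (hr_anti hk') (hu_nonneg _)
  have h2 : ∑ k ∈ range (m' + 1 + 1), u (m' + 1 - k) = 1 + bridgeGFpos (m' + 1) μ⁻¹ := by
    have hrefl : ∑ k ∈ range (m' + 1 + 1), u (m' + 1 - k) = ∑ k ∈ range (m' + 1 + 1), u k := by
      have := Finset.sum_range_reflect u (m' + 1 + 1)
      simpa using this
    rw [hrefl, bridgeGFpos, Finset.sum_range_succ',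
      Finset.sum_range_succ' (fun n => if n = 0 then (0 : ℝ) else (bridgeCount n : ℝ) * μ⁻¹ ^ n)]
    simp only [Nat.succ_ne_zero, if_false, if_true, hu0, add_zero]
    rw [add_comm]
    congr 1
    refine Finset.sum_congr rfl fun n _ => ?_
    simp only [hu, inv_pow, div_eq_mul_inv]
  have h3 : Real.log ((m' + 1 : ℝ) / μ) / 2 ≤ bridgeGFpos (m' + 1) μ⁻¹ := half_log_le_sum_bridgeCount m'
  have hlog0 : 0 ≤ Real.log (((m' + 1 : ℕ) : ℝ) / μ) := by
    refine Real.log_nonneg ?_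
    rw [le_div_iff₀ hμ, one_mul]; exact hμm
  have hm1 : ((m' + 1 : ℕ) : ℝ) = (m' : ℝ) + 1 := by push_cast; ring
  rw [hm1] at hlog0 ⊢
  have hU : 1 + Real.log (((m' : ℝ) + 1) / μ) / 2 ≤ ∑ k ∈ range (m' + 1 + 1), u (m' + 1 - k) := by
    rw [h2]; linarith
  have hUpos : 0 < 1 + Real.log (((m' : ℝ) + 1) / μ) / 2 := by linarith
  have hrm : r (m' + 1) = 1 - ∑ k ∈ Icc 1 (m' + 1), f k := by
    rw [hr, Finset.sum_range_succ', hf0, add_zero, sum_Icc_one_eq_sum_range]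
  rw [← hrm, le_div_iff₀ hUpos]
  calc r (m' + 1) * (1 + Real.log (((m' : ℝ) + 1) / μ) / 2)
      ≤ r (m' + 1) * ∑ k ∈ range (m' + 1 + 1), u (m' + 1 - k) := by
        refine mul_le_mul_of_nonneg_left hU ?_
        rw [hr]
        have := sum_irreducibleBridgeCount_div_pow_le_one (range (m' + 1 + 1))
        linarith
    _ ≤ 1 := h1

end HexBW

/-- `μ_ℍ² = 2 + √2` and `1 ≤ μ_ℍ`. [cite: DuminilCopinSmirnov2012, Theorem 1] -/
private theorem hexMu_facts : hexConnectiveConstant ^ 2 = 2 + Real.sqrt 2 ∧ 1 ≤ hexConnectiveConstant := by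
  have hμ := hexConnectiveConstant_eq_of_thm1 DuminilCopinSmirnov2012_thm1_holds
  refine ⟨?_, one_le_hexConnectiveConstant⟩
  rw [hμ]; exact Real.sq_sqrt (by positivity)

/-- **`|b_{N+1}(ℍ)/b_N(ℍ) − μ_ℍ| ≤ K / log N` for all `N ≥ 2`** — Madras–Slade Theorem 7.3.4(d) on `ℍ` WITH A RATE:
the model-free engine `Renewal.LogRate.ratio_rate_log_of` fed with the brick-wall renewal equation (as an inequality),
`λ₁(ℍ) = 1`, the partial sums and the explicit tail of Kesten's relation, and the upper side of the two-step rate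
`HV.hexBridgeRatioTwo_rate_mixed`.  Not in print for any lattice (ℤ^d: the tree's `Zd.bridgeRatio_rate_log`).
[cite: MadrasSlade1993, Theorem 7.3.4 (d) (quantitative form), proof pp. 248–249 ((7.3.13), (7.3.14)); LawlerSchrammWerner2004SAW, Appendix (A.3)] -/
theorem hexBridgeRatioOne_rate : ∃ K : ℝ, ∀ N : ℕ, 2 ≤ N →
    |(HexBW.bridgeCount (N + 1) : ℝ) / HexBW.bridgeCount N - hexConnectiveConstant| ≤ K / Real.log N := by
  obtain ⟨hμsq, hμ1⟩ := hexMu_facts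
  have hμ : 0 < hexConnectiveConstant := hexConnectiveConstant_pos
  have hw : ∀ n, (0 : ℝ) < HexBW.bridgeCount n := fun n => by exact_mod_cast HexBW.one_le_bridgeCount n
  have hlam0 : ∀ k, (0 : ℝ) ≤ (HexBW.irreducibleBridgeCount k : ℝ) := fun k => Nat.cast_nonneg _
  have hlam1 : (1 : ℝ) ≤ (HexBW.irreducibleBridgeCount 1 : ℝ) := by
    have h := HexBW.irreducibleBridgeCount_one_pos
    exact_mod_cast Nat.one_le_iff_ne_zero.2 (Nat.pos_iff_ne_zero.1 h)
  have hren : ∀ n : ℕ, 1 ≤ n → ∑ k ∈ Icc 1 n, (HexBW.irreducibleBridgeCount k : ℝ) *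
      HexBW.bridgeCount (n - k) ≤ HexBW.bridgeCount n := fun n hn => by
    have h := HexBW.bridgeCount_eq_sum_Icc hn
    have h' : (HexBW.bridgeCount n : ℝ) =
        ∑ k ∈ Icc 1 n, (HexBW.irreducibleBridgeCount k : ℝ) * HexBW.bridgeCount (n - k) := by
      rw [h]; push_cast; rfl
    rw [h']
  have hU : ∃ K' : ℝ, ∃ N₀ : ℕ, ∀ N : ℕ, N₀ ≤ N → (HexBW.bridgeCount (N + 2) : ℝ) / HexBW.bridgeCount N ≤
      hexConnectiveConstant ^ 2 * (1 + K' * (N : ℝ) ^ (-(1 : ℝ) / 4)) := by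
    obtain ⟨K, N₀, hK⟩ := HV.hexBridgeRatioTwo_rate_mixed
    refine ⟨K / hexConnectiveConstant ^ 2, N₀, fun N hN => ?_⟩
    have h2 := (hK N hN).2
    have : hexConnectiveConstant ^ 2 * (1 + K / hexConnectiveConstant ^ 2 * (N : ℝ) ^ (-(1 : ℝ) / 4)) =
        hexConnectiveConstant ^ 2 + K * (N : ℝ) ^ (-(1 : ℝ) / 4) := by
      field_simp
    rw [this, hμsq]
    linarith
  have hsum' : ∀ s : Finset ℕ, ∑ k ∈ s, (fun k => (HexBW.irreducibleBridgeCount k : ℝ)) k /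
      hexConnectiveConstant ^ k ≤ 1 := fun s => HexBW.sum_irreducibleBridgeCount_div_pow_le_one s
  have htail' : ∀ m : ℕ, 1 ≤ m → hexConnectiveConstant ≤ m →
      1 - ∑ k ∈ Icc 1 m, (fun k => (HexBW.irreducibleBridgeCount k : ℝ)) k / hexConnectiveConstant ^ k ≤
        1 / (1 + Real.log ((m : ℝ) / hexConnectiveConstant) / 2) :=
    fun m hm hμm => HexBW.kestenTail_le_inv_log hm hμm
  have hmain := _root_.Literature.Probability.Process.Renewal.LogRate.ratio_rate_log_of
    (β := hexConnectiveConstant) (lam := fun k => (HexBW.irreducibleBridgeCount k : ℝ))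
    (w := fun n => (HexBW.bridgeCount n : ℝ)) hμ1 hw hlam0 hlam1 hsum' htail' hren hU
  beta_reduce at hmain
  exact hmain

/-- **`|h_{N+1}(ℍ)/h_N(ℍ) − μ_ℍ| ≤ K / log N` for all `N ≥ 2`** — Lawler–Schramm–Werner (A.3) on `ℍ` WITH A RATE:
the same engine with the renewal INEQUALITY `Σ_j λ_j(ℍ) h_{n−j}(ℍ) ≤ h_n(ℍ)` and the two-step rate
`hexHalfSpaceRatioTwo_rate` (`K N^{-1/3} ≤ K N^{-1/4}` for `N ≥ 1`).  Not in print for any lattice.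
[cite: LawlerSchrammWerner2004SAW, Appendix (A.3) (quantitative form); MadrasSlade1993, Theorem 7.3.4 (d), proof (7.3.14)] -/
theorem hexHalfSpaceRatioOne_rate : ∃ K : ℝ, ∀ N : ℕ, 2 ≤ N →
    |(HexBW.halfSpaceCount (N + 1) : ℝ) / HexBW.halfSpaceCount N - hexConnectiveConstant| ≤ K / Real.log N := by
  obtain ⟨hμsq, hμ1⟩ := hexMu_facts
  have hμ : 0 < hexConnectiveConstant := hexConnectiveConstant_pos
  have hw : ∀ n, (0 : ℝ) < HexBW.halfSpaceCount n := fun n => by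
    have h1 : (1 : ℝ) ≤ HexBW.bridgeCount n := by exact_mod_cast HexBW.one_le_bridgeCount n
    have h2 : (HexBW.bridgeCount n : ℝ) ≤ HexBW.halfSpaceCount n := by
      exact_mod_cast Finset.card_le_card (HexBW.bridges_subset_halfSpaceWalks n)
    linarith
  have hlam0 : ∀ k, (0 : ℝ) ≤ (HexBW.irreducibleBridgeCount k : ℝ) := fun k => Nat.cast_nonneg _
  have hlam1 : (1 : ℝ) ≤ (HexBW.irreducibleBridgeCount 1 : ℝ) := by
    have h := HexBW.irreducibleBridgeCount_one_pos
    exact_mod_cast Nat.one_le_iff_ne_zero.2 (Nat.pos_iff_ne_zero.1 h)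
  have hren : ∀ n : ℕ, 1 ≤ n → ∑ k ∈ Icc 1 n, (HexBW.irreducibleBridgeCount k : ℝ) *
      HexBW.halfSpaceCount (n - k) ≤ HexBW.halfSpaceCount n := fun n _ => by
    exact_mod_cast HexBW.sum_irreducibleBridgeCount_mul_halfSpaceCount_le n
  have hU : ∃ K' : ℝ, ∃ N₀ : ℕ, ∀ N : ℕ, N₀ ≤ N → (HexBW.halfSpaceCount (N + 2) : ℝ) / HexBW.halfSpaceCount N ≤
      hexConnectiveConstant ^ 2 * (1 + K' * (N : ℝ) ^ (-(1 : ℝ) / 4)) := by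
    obtain ⟨K, hK⟩ := hexHalfSpaceRatioTwo_rate
    refine ⟨max K 0 / hexConnectiveConstant ^ 2, 1, fun N hN => ?_⟩
    have h2 := (abs_le.1 (hK N hN)).2
    have hN0 : (1 : ℝ) ≤ N := by exact_mod_cast hN
    have hr3 : (N : ℝ) ^ (-(1 : ℝ) / 3) ≤ (N : ℝ) ^ (-(1 : ℝ) / 4) :=
      Real.rpow_le_rpow_of_exponent_le hN0 (by norm_num)
    have hr0 : 0 ≤ (N : ℝ) ^ (-(1 : ℝ) / 3) := Real.rpow_nonneg (by linarith) _
    have hKr : K * (N : ℝ) ^ (-(1 : ℝ) / 3) ≤ max K 0 * (N : ℝ) ^ (-(1 : ℝ) / 4) :=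
      (mul_le_mul_of_nonneg_right (le_max_left K 0) hr0).trans
        (mul_le_mul_of_nonneg_left hr3 (le_max_right K 0))
    have : hexConnectiveConstant ^ 2 * (1 + max K 0 / hexConnectiveConstant ^ 2 * (N : ℝ) ^ (-(1 : ℝ) / 4)) =
        hexConnectiveConstant ^ 2 + max K 0 * (N : ℝ) ^ (-(1 : ℝ) / 4) := by
      field_simp
    rw [this, hμsq]
    linarith
  have hsum' : ∀ s : Finset ℕ, ∑ k ∈ s, (fun k => (HexBW.irreducibleBridgeCount k : ℝ)) k /
      hexConnectiveConstant ^ k ≤ 1 := fun s => HexBW.sum_irreducibleBridgeCount_div_pow_le_one s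
  have htail' : ∀ m : ℕ, 1 ≤ m → hexConnectiveConstant ≤ m →
      1 - ∑ k ∈ Icc 1 m, (fun k => (HexBW.irreducibleBridgeCount k : ℝ)) k / hexConnectiveConstant ^ k ≤
        1 / (1 + Real.log ((m : ℝ) / hexConnectiveConstant) / 2) :=
    fun m hm hμm => HexBW.kestenTail_le_inv_log hm hμm
  have hmain := _root_.Literature.Probability.Process.Renewal.LogRate.ratio_rate_log_of
    (β := hexConnectiveConstant) (lam := fun k => (HexBW.irreducibleBridgeCount k : ℝ))
    (w := fun n => (HexBW.halfSpaceCount n : ℝ)) hμ1 hw hlam0 hlam1 hsum' htail' hren hU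
  beta_reduce at hmain
  exact hmain

end Literature.Probability.RandomPlanarGeometry.SAW
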